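import Mathlib.Topology.ContinuousMap.StoneWeierstrass
import Mathlib.Topology.UrysohnsLemma
import HarnessLib

/-!
# Finite sums of products `Σ αᵢ(x) βᵢ(y)` are dense in `C(X × Y, ℝ)` (Stone–Weierstrass)

For compact Hausdorff spaces `X`, `Y`, every continuous `f : X × Y → ℝ` is uniformly approximated
by finite sums `Σᵢ αᵢ(x) βᵢ(y)` of products of continuous functions on the factors
(`exists_sum_mul_near_continuous`). This is the Stone–Weierstrass theorem
(`ContinuousMap.exists_mem_subalgebra_near_continuous_of_separatesPoints`) applied to the
subalgebra of such sums, which separates points by Urysohn's lemma on the factors. Used in the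
tree to build jointly smooth "tensor" heat flows `Σ (P αᵢ)(x, t) (P βᵢ)(y, t)` on `M × M`
approximating a given continuous initial datum (Bamler 2020a, proof of Cor. 3.6).

Everything is proved; no definitions (the subalgebra is built inside the proof), no named facts.

## References

* M. H. Stone, *The generalized Weierstrass approximation theorem*, Math. Mag. 21 (1948).
* R. H. Bamler, *Entropy and heat kernel bounds on a Ricci flow background*, arXiv:2008.07093
  (2020), §3 (proof of Cor. 3.6). [Bamler2020Entropy]
-/

noncomputable section

open Set Filter Topology

namespace Literature.Topology

variable {X Y : Type*} [TopologicalSpace X] [TopologicalSpace Y]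

omit [TopologicalSpace X] [TopologicalSpace Y] in
/-- Concatenation of two finite families indexed by `Fin n` and `Fin m`. [folklore] -/
theorem sum_fin_append {n m : ℕ} (a : Fin n → ℝ) (b : Fin m → ℝ) :
    ∑ i, Fin.append a b i = ∑ i, a i + ∑ i, b i := by
  rw [Fin.sum_univ_add]
  simp

/-- Sums of finite sums of products `Σ αᵢ(x) βᵢ(y)` are finite sums of products. [folklore] -/
theorem exists_sum_mul_rep_add {F G : C(X × Y, ℝ)}
    (hF : ∃ (n : ℕ) (α : Fin n → C(X, ℝ)) (β : Fin n → C(Y, ℝ)), ∀ p, F p = ∑ i, α i p.1 * β i p.2)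
    (hG : ∃ (n : ℕ) (α : Fin n → C(X, ℝ)) (β : Fin n → C(Y, ℝ)), ∀ p, G p = ∑ i, α i p.1 * β i p.2) :
    ∃ (n : ℕ) (α : Fin n → C(X, ℝ)) (β : Fin n → C(Y, ℝ)), ∀ p, (F + G) p = ∑ i, α i p.1 * β i p.2 := by
  obtain ⟨n, α, β, hF⟩ := hF
  obtain ⟨m, α', β', hG⟩ := hG
  refine ⟨n + m, Fin.append α α', Fin.append β β', fun p ↦ ?_⟩
  rw [ContinuousMap.add_apply, hF, hG]
  have := sum_fin_append (fun i ↦ α i p.1 * β i p.2) (fun i ↦ α' i p.1 * β' i p.2)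
  rw [← this]
  refine Finset.sum_congr rfl fun i _ ↦ ?_
  refine Fin.addCases (fun j ↦ ?_) (fun j ↦ ?_) i <;> simp

/-- Products of finite sums of products are finite sums of products. [folklore] -/
theorem exists_sum_mul_rep_mul {F G : C(X × Y, ℝ)}
    (hF : ∃ (n : ℕ) (α : Fin n → C(X, ℝ)) (β : Fin n → C(Y, ℝ)), ∀ p, F p = ∑ i, α i p.1 * β i p.2)
    (hG : ∃ (n : ℕ) (α : Fin n → C(X, ℝ)) (β : Fin n → C(Y, ℝ)), ∀ p, G p = ∑ i, α i p.1 * β i p.2) :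
    ∃ (n : ℕ) (α : Fin n → C(X, ℝ)) (β : Fin n → C(Y, ℝ)), ∀ p, (F * G) p = ∑ i, α i p.1 * β i p.2 := by
  obtain ⟨n, α, β, hF⟩ := hF
  obtain ⟨m, α', β', hG⟩ := hG
  -- index the double sum by `Fin (n * m)` through `finProdFinEquiv`
  refine ⟨n * m, fun k ↦ α (finProdFinEquiv.symm k).1 * α' (finProdFinEquiv.symm k).2,
    fun k ↦ β (finProdFinEquiv.symm k).1 * β' (finProdFinEquiv.symm k).2, fun p ↦ ?_⟩
  rw [ContinuousMap.mul_apply, hF, hG, Finset.sum_mul_sum, ← Finset.sum_product',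
    Finset.univ_product_univ]
  refine Fintype.sum_equiv finProdFinEquiv _ _ fun q ↦ ?_
  simp only [Equiv.symm_apply_apply, ContinuousMap.mul_apply]
  ring

/-- `α(p.1) · c` is a (one-term) sum of products. [folklore] -/
theorem exists_sum_mul_rep_fst (α : C(X, ℝ)) (c : ℝ) :
    ∃ (n : ℕ) (α' : Fin n → C(X, ℝ)) (β : Fin n → C(Y, ℝ)), ∀ p : X × Y,
      (c • α.comp ContinuousMap.fst : C(X × Y, ℝ)) p = ∑ i, α' i p.1 * β i p.2 :=
  ⟨1, fun _ ↦ α, fun _ ↦ ContinuousMap.const Y c, fun p ↦ by simp [mul_comm]⟩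

/-- `β(p.2)` is a (one-term) sum of products. [folklore] -/
theorem exists_sum_mul_rep_snd (β : C(Y, ℝ)) :
    ∃ (n : ℕ) (α : Fin n → C(X, ℝ)) (β' : Fin n → C(Y, ℝ)), ∀ p : X × Y,
      (β.comp ContinuousMap.snd : C(X × Y, ℝ)) p = ∑ i, α i p.1 * β' i p.2 :=
  ⟨1, fun _ ↦ ContinuousMap.const X 1, fun _ ↦ β, fun p ↦ by simp⟩

/-- **Finite sums of products are uniformly dense in `C(X × Y, ℝ)`** for compact Hausdorff `X, Y`
(Stone–Weierstrass for the subalgebra of finite sums `Σ αᵢ(x) βᵢ(y)`, which separates points by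
Urysohn's lemma on the factors): for continuous `f : X × Y → ℝ` and `ε > 0` there are `n` and
continuous `αᵢ : X → ℝ`, `βᵢ : Y → ℝ` with `|f(x, y) − Σᵢ αᵢ(x) βᵢ(y)| < ε` for all `(x, y)`.
[folklore] -/
theorem exists_sum_mul_near_continuous [T2Space X] [CompactSpace X] [T2Space Y] [CompactSpace Y]
    {f : X × Y → ℝ} (hf : Continuous f) {ε : ℝ} (hε : 0 < ε) :
    ∃ (n : ℕ) (α : Fin n → C(X, ℝ)) (β : Fin n → C(Y, ℝ)),
      ∀ p : X × Y, |f p - ∑ i, α i p.1 * β i p.2| < ε := by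
  -- the subalgebra of finite sums of products
  let A : Subalgebra ℝ C(X × Y, ℝ) :=
    { carrier := {F | ∃ (n : ℕ) (α : Fin n → C(X, ℝ)) (β : Fin n → C(Y, ℝ)),
        ∀ p, F p = ∑ i, α i p.1 * β i p.2}
      mul_mem' := fun hF hG ↦ exists_sum_mul_rep_mul hF hG
      one_mem' := by
        obtain ⟨n, α', β, h⟩ := exists_sum_mul_rep_fst (Y := Y) (ContinuousMap.const X (1 : ℝ)) 1
        exact ⟨n, α', β, fun p ↦ by rw [← h p]; simp⟩
      add_mem' := fun hF hG ↦ exists_sum_mul_rep_add hF hG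
      zero_mem' := ⟨0, Fin.elim0, Fin.elim0, fun p ↦ by simp⟩
      algebraMap_mem' := fun c ↦ by
        obtain ⟨n, α', β, h⟩ := exists_sum_mul_rep_fst (Y := Y) (ContinuousMap.const X (1 : ℝ)) c
        exact ⟨n, α', β, fun p ↦ by rw [← h p]; simp [Algebra.algebraMap_eq_smul_one]⟩ }
  -- it separates points
  have hsep : A.SeparatesPoints := by
    rintro ⟨x, y⟩ ⟨x', y'⟩ hne
    by_cases hx : x = x'
    · subst hx
      have hy : y ≠ y' := fun h ↦ hne (by rw [h])
      obtain ⟨β, hβ0, hβ1, -⟩ := exists_continuous_zero_one_of_isClosed (isClosed_singleton (x := y))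
        (isClosed_singleton (x := y')) (disjoint_singleton.2 hy)
      refine ⟨fun p ↦ β p.2, ⟨β.comp ContinuousMap.snd, exists_sum_mul_rep_snd β, rfl⟩, ?_⟩
      simp only
      rw [hβ0 (mem_singleton y), hβ1 (mem_singleton y')]
      simp
    · obtain ⟨α, hα0, hα1, -⟩ := exists_continuous_zero_one_of_isClosed (isClosed_singleton (x := x))
        (isClosed_singleton (x := x')) (disjoint_singleton.2 hx)
      refine ⟨fun p ↦ α p.1, ⟨(1 : ℝ) • α.comp ContinuousMap.fst, exists_sum_mul_rep_fst α 1, ?_⟩, ?_⟩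
      · ext p; simp
      · simp only
        rw [hα0 (mem_singleton x), hα1 (mem_singleton x')]
        simp
  obtain ⟨g, hg⟩ := ContinuousMap.exists_mem_subalgebra_near_continuous_of_separatesPoints
    A hsep f hf ε hε
  obtain ⟨n, α, β, hrep⟩ : ∃ (n : ℕ) (α : Fin n → C(X, ℝ)) (β : Fin n → C(Y, ℝ)),
      ∀ p, (g : C(X × Y, ℝ)) p = ∑ i, α i p.1 * β i p.2 := g.2
  refine ⟨n, α, β, fun p ↦ ?_⟩
  have := hg p
  rw [Real.norm_eq_abs] at this
  rw [abs_sub_comm, ← hrep p]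
  exact this

end Literature.Topology

end
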